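import Literature.IUT.HodgeTheaters.TemperedCoveringsCor23iiiOfSpecialFibre
import Literature.IUT.HodgeTheaters.TemperedCoveringsCentreFree
import HarnessLib

/-!
# [IUTchI] Cor. 2.3 (i)–(iv) at the genuine 𝔛-datum: the level family `J`/`hcof` ELIMINATED (binder reduction)

Mochizuki, *Inter-universal Teichmüller theory I*, kurims manuscript (May 2020), §2, Cor. 2.3 (iii), proof
p. 48 ("for a cofinal system of characteristic open subgroups") [cite: Mochizuki2012, Cor 2.3 pp.47-49] (D-0012
claim key; series status DISPUTED; nothing of the series is asserted here).

PROOF-ONLY companion (abc-iut cell, layer L5; seat abc-iut-L5-d5 gen 5, CERT-L5 second reader) of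
abc-iut-w4-d058's `TemperedCoveringsCor23iiiOfSpecialFibre.lean` (`cor23_i_to_iv_ofSpecialFibre`).  That
assembly takes a DATA binder `J : I → Subgroup Δ̂_X`, a cofinality law `hcof` and the KER-LEVEL slimness
conclusions `hA` / `hB` AT THE LEVELS `J i`.  Pure logic over a topological group (`kerLevel_all_of_cofinal`):
the KER-LEVEL conclusion at a cofinal family of normal open levels implies it at EVERY normal open subgroup
(an element commuting with `W ∩ Ker ρ̂` commutes with `J i ∩ Ker ρ̂` for `J i ≤ W`, hence lies in `J i ≤ W`), and
conversely the family of all normal open subgroups is cofinal.  Hence (`cor23_i_to_iv_ofSpecialFibre_allLevels`)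
the same four conjuncts from the `J`-FREE binders `hA'` / `hB'` (KER-LEVEL conclusion at every normal open
`W ⊆ Δ̂_X`): one data binder and one law binder fewer, equivalent hypothesis set (binder-reduction currency of
`Summits/ABC/IUTFork/Conditional/Layer5OfS.lean`, class (c) §2).  Moreover (`cor23_i_to_iv_ofSpecialFibre_reduced`)
the PROFINITE outer-descent binder `hOutHat` is DERIVED at the datum from the tempered one `hOutTp` and (ii)
(abc-iut-w4-d060/w4-d058's `outerHat_of_outerTp`, fed with abc-iut-L5-d4's `cor23ii_of_density` whose topological
side conditions are theorems at the datum), so the §2 assembly needs only `h22`, `hH`, `hker`, `hOutTp`, `hA'`, `hB'`.  0 definitions; nothing here bears on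
[IUTchIII] Cor. 3.12; typed ≠ discharged.
-/

noncomputable section

namespace Literature.IUT.HodgeTheaters

open Pointwise Topology
open Literature.AnabelianGeometry.SemiGraphs

/-- **Cofinal KER-LEVEL conclusions give ALL-LEVEL conclusions** (pure group bookkeeping): if the normal open
subgroups `W` of `G` are dominated by the family `J` (`hcof`) and, at every level `J i`, an element commuting
with `J i ∩ K` lies in `J i` (`hA`), then at every normal open `W` an element commuting with `W ∩ K` lies in `W`.
[cite: Mochizuki2012, Cor 2.3(iii) p.48] -/
theorem kerLevel_all_of_cofinal {G : Type*} [Group G] [TopologicalSpace G] (K : Set G) {I : Type*}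
    (J : I → Subgroup G) (hcof : ∀ W : Subgroup G, W.Normal → IsOpen (W : Set G) → ∃ i, J i ≤ W)
    (hA : ∀ i (a : G), (∀ x ∈ J i, x ∈ K → a * x = x * a) → a ∈ J i) :
    ∀ W : Subgroup G, W.Normal → IsOpen (W : Set G) → ∀ a : G, (∀ x ∈ W, x ∈ K → a * x = x * a) → a ∈ W := by
  intro W hWn hWo a ha
  obtain ⟨i, hi⟩ := hcof W hWn hWo
  exact hi (hA i a fun x hx hxK => ha x (hi hx) hxK)

/-- **The family of all normal open subgroups is cofinal, and ALL-LEVEL conclusions restrict to it** — the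
converse bookkeeping of `kerLevel_all_of_cofinal`. [cite: Mochizuki2012, Cor 2.3(iii) p.48] -/
theorem kerLevel_cofinal_of_all {G : Type*} [Group G] [TopologicalSpace G] (K : Set G)
    (hA' : ∀ W : Subgroup G, W.Normal → IsOpen (W : Set G) → ∀ a : G, (∀ x ∈ W, x ∈ K → a * x = x * a) → a ∈ W) :
    (∀ W : Subgroup G, W.Normal → IsOpen (W : Set G) →
        ∃ i : {W : Subgroup G // W.Normal ∧ IsOpen (W : Set G)}, i.1 ≤ W) ∧
      ∀ (i : {W : Subgroup G // W.Normal ∧ IsOpen (W : Set G)}) (a : G),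
        (∀ x ∈ i.1, x ∈ K → a * x = x * a) → a ∈ i.1 :=
  ⟨fun W hn ho => ⟨⟨W, hn, ho⟩, le_rfl⟩, fun i a h => hA' i.1 i.2.1 i.2.2 a h⟩

namespace StableCurveTemperedData

section

variable {p : ℕ} [Fact p.Prime] (X : TemperedCurve p) (d : X.GroupLevelData)
  (S : SpecialFibreData (X.toTemperedArithmeticGroup d)) (h36 : S.Gc.Prop36Hypotheses)
  (Sigma SigmaHat : Set ℕ) (hsub : Sigma ⊆ SigmaHat) (hne : Sigma.Nonempty)
  (hprime : ∀ q ∈ SigmaHat, q.Prime) (hp : p ∉ Sigma)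
  (TpH : Subgroup S.chart.G)
  (HatH : Subgroup (TemperedGraphGroupData.exists_completion_of_prop36 S.Gc h36 S.chart).choose)
  (hle : TpH.map (TemperedGraphGroupData.exists_completion_of_prop36 S.Gc h36
    S.chart).choose_spec.choose.toMonoidHom ≤ HatH)
  (cuspMeetsH : {x : X.Pt // X.IsCusp x} → Prop)

/-- **[IUTchI] Cor. 2.3 (i)–(iv) AS TYPED at the genuine 𝔛-datum `ofSpecialFibre`, `J`-FREE FORM**: as
abc-iut-w4-d058's `cor23_i_to_iv_ofSpecialFibre`, with the level family `J`, its cofinality `hcof` and the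
per-level KER-LEVEL conclusions `hA`/`hB` replaced by the KER-LEVEL conclusions `hA'`/`hB'` at EVERY normal open
`W ⊆ Δ̂_X` (equivalent hypothesis set: `kerLevel_all_of_cofinal` / `kerLevel_cofinal_of_all`; instantiate the
assembly at the family of all normal open subgroups).  Remaining binders: `h22`, `hH`, `hker`, `hOutTp`,
`hOutHat`, `hA'`, `hB'`. [cite: Mochizuki2012, Cor 2.3 pp.47-49] -/
theorem cor23_i_to_iv_ofSpecialFibre_allLevels
    (h22 : (ofSpecialFibre X d S h36 Sigma SigmaHat hsub hne hprime hp TpH HatH hle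
      cuspMeetsH).graph.CommensuratorsOfDecompositionSubgroups)
    (hH : ((ofSpecialFibre X d S h36 Sigma SigmaHat hsub hne hprime hp TpH HatH hle cuspMeetsH).graph.HatH :
        Set (ofSpecialFibre X d S h36 Sigma SigmaHat hsub hne hprime hp TpH HatH hle cuspMeetsH).graph.Hat) =
      closure ((ofSpecialFibre X d S h36 Sigma SigmaHat hsub hne hprime hp TpH HatH hle cuspMeetsH).graph.ι ''
        (ofSpecialFibre X d S h36 Sigma SigmaHat hsub hne hprime hp TpH HatH hle cuspMeetsH).graph.TpH))
    (hker : ((ofSpecialFibre X d S h36 Sigma SigmaHat hsub hne hprime hp TpH HatH hle cuspMeetsH).ρHat.ker :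
        Set (ofSpecialFibre X d S h36 Sigma SigmaHat hsub hne hprime hp TpH HatH hle cuspMeetsH).DeltaHat) ⊆
      closure (((ofSpecialFibre X d S h36 Sigma SigmaHat hsub hne hprime hp TpH HatH hle cuspMeetsH).ιΔ.range :
          Set (ofSpecialFibre X d S h36 Sigma SigmaHat hsub hne hprime hp TpH HatH hle cuspMeetsH).DeltaHat) ∩
        ((ofSpecialFibre X d S h36 Sigma SigmaHat hsub hne hprime hp TpH HatH hle cuspMeetsH).ρHat.ker :
          Set (ofSpecialFibre X d S h36 Sigma SigmaHat hsub hne hprime hp TpH HatH hle cuspMeetsH).DeltaHat)))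
    (hOutTp : ∀ g : (ofSpecialFibre X d S h36 Sigma SigmaHat hsub hne hprime hp TpH HatH hle cuspMeetsH).PiTp,
      ∃ δ : (ofSpecialFibre X d S h36 Sigma SigmaHat hsub hne hprime hp TpH HatH hle cuspMeetsH).DeltaTp,
        MulAut.conj g • ((ofSpecialFibre X d S h36 Sigma SigmaHat hsub hne hprime hp TpH HatH hle
            cuspMeetsH).deltaTpH.map
          (ofSpecialFibre X d S h36 Sigma SigmaHat hsub hne hprime hp TpH HatH hle cuspMeetsH).DeltaTp.subtype) =
        MulAut.conj (δ : (ofSpecialFibre X d S h36 Sigma SigmaHat hsub hne hprime hp TpH HatH hle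
            cuspMeetsH).PiTp) •
          ((ofSpecialFibre X d S h36 Sigma SigmaHat hsub hne hprime hp TpH HatH hle cuspMeetsH).deltaTpH.map
            (ofSpecialFibre X d S h36 Sigma SigmaHat hsub hne hprime hp TpH HatH hle cuspMeetsH).DeltaTp.subtype))
    (hOutHat : ∀ γ : (ofSpecialFibre X d S h36 Sigma SigmaHat hsub hne hprime hp TpH HatH hle cuspMeetsH).PiHat,
      ∃ δ : (ofSpecialFibre X d S h36 Sigma SigmaHat hsub hne hprime hp TpH HatH hle cuspMeetsH).DeltaHat,
        MulAut.conj γ • ((ofSpecialFibre X d S h36 Sigma SigmaHat hsub hne hprime hp TpH HatH hle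
            cuspMeetsH).deltaHatH.map
          (ofSpecialFibre X d S h36 Sigma SigmaHat hsub hne hprime hp TpH HatH hle cuspMeetsH).DeltaHat.subtype) =
        MulAut.conj (δ : (ofSpecialFibre X d S h36 Sigma SigmaHat hsub hne hprime hp TpH HatH hle
            cuspMeetsH).PiHat) •
          ((ofSpecialFibre X d S h36 Sigma SigmaHat hsub hne hprime hp TpH HatH hle cuspMeetsH).deltaHatH.map
            (ofSpecialFibre X d S h36 Sigma SigmaHat hsub hne hprime hp TpH HatH hle cuspMeetsH).DeltaHat.subtype))
    (hA' : (∃ l ∈ SigmaHat, l ∉ Sigma ∧ l ≠ p) →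
      ∀ W : Subgroup (ofSpecialFibre X d S h36 Sigma SigmaHat hsub hne hprime hp TpH HatH hle cuspMeetsH).DeltaHat,
        W.Normal → IsOpen (W : Set (ofSpecialFibre X d S h36 Sigma SigmaHat hsub hne hprime hp TpH HatH hle
          cuspMeetsH).DeltaHat) →
        ∀ a : (ofSpecialFibre X d S h36 Sigma SigmaHat hsub hne hprime hp TpH HatH hle cuspMeetsH).DeltaHat,
          (∀ x ∈ W, x ∈ (ofSpecialFibre X d S h36 Sigma SigmaHat hsub hne hprime hp TpH HatH hle
            cuspMeetsH).ρHat.ker → a * x = x * a) → a ∈ W)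
    (hB' : SigmaHat = {q | q.Prime} →
      ∀ W : Subgroup (ofSpecialFibre X d S h36 Sigma SigmaHat hsub hne hprime hp TpH HatH hle cuspMeetsH).DeltaHat,
        W.Normal → IsOpen (W : Set (ofSpecialFibre X d S h36 Sigma SigmaHat hsub hne hprime hp TpH HatH hle
          cuspMeetsH).DeltaHat) →
        ∀ a : (ofSpecialFibre X d S h36 Sigma SigmaHat hsub hne hprime hp TpH HatH hle cuspMeetsH).DeltaHat,
          (∀ x ∈ W, x ∈ (ofSpecialFibre X d S h36 Sigma SigmaHat hsub hne hprime hp TpH HatH hle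
            cuspMeetsH).ρHat.ker → a * x = x * a) → a ∈ W) :
    (ofSpecialFibre X d S h36 Sigma SigmaHat hsub hne hprime hp TpH HatH hle cuspMeetsH).Cor23i ∧
      (ofSpecialFibre X d S h36 Sigma SigmaHat hsub hne hprime hp TpH HatH hle cuspMeetsH).Cor23ii ∧
      (ofSpecialFibre X d S h36 Sigma SigmaHat hsub hne hprime hp TpH HatH hle cuspMeetsH).Cor23iii ∧
      (ofSpecialFibre X d S h36 Sigma SigmaHat hsub hne hprime hp TpH HatH hle cuspMeetsH).Cor23iv :=
  cor23_i_to_iv_ofSpecialFibre X d S h36 Sigma SigmaHat hsub hne hprime hp TpH HatH hle cuspMeetsH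
    h22 hH hker hOutTp hOutHat
    (fun W : {W : Subgroup (ofSpecialFibre X d S h36 Sigma SigmaHat hsub hne hprime hp TpH HatH hle
        cuspMeetsH).DeltaHat // W.Normal ∧ IsOpen (W : Set (ofSpecialFibre X d S h36 Sigma SigmaHat hsub hne
          hprime hp TpH HatH hle cuspMeetsH).DeltaHat)} => W.1)
    (fun W hn ho => ⟨⟨W, hn, ho⟩, le_rfl⟩)
    (fun h i a ha => hA' h i.1 i.2.1 i.2.2 a ha)
    (fun h i a ha => hB' h i.1 i.2.1 i.2.2 a ha)

/-- **[IUTchI] Cor. 2.3 (i)–(iv) AS TYPED at the genuine 𝔛-datum — REDUCED binder set**: `h22` (Prop. 2.2 for the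
𝔾-data), the two density facts `hH`/`hker` of (ii), the TEMPERED outer-descent atom `hOutTp`, and the `J`-free
KER-LEVEL conclusions `hA'`/`hB'`.  The profinite outer-descent atom is derived: `outerHat_of_outerTp` (tempered
descent + Cor. 2.3 (ii), the latter from `hH`/`hker` by abc-iut-L5-d4's `cor23ii_of_density`, whose side conditions
`Δ̂_X` closed / `ρ̂` continuous / `Π̂_𝔾` Hausdorff are abc-iut-w4-d058's theorems at the datum).
[cite: Mochizuki2012, Cor 2.3 pp.47-49] -/
theorem cor23_i_to_iv_ofSpecialFibre_reduced
    (h22 : (ofSpecialFibre X d S h36 Sigma SigmaHat hsub hne hprime hp TpH HatH hle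
      cuspMeetsH).graph.CommensuratorsOfDecompositionSubgroups)
    (hH : ((ofSpecialFibre X d S h36 Sigma SigmaHat hsub hne hprime hp TpH HatH hle cuspMeetsH).graph.HatH :
        Set (ofSpecialFibre X d S h36 Sigma SigmaHat hsub hne hprime hp TpH HatH hle cuspMeetsH).graph.Hat) =
      closure ((ofSpecialFibre X d S h36 Sigma SigmaHat hsub hne hprime hp TpH HatH hle cuspMeetsH).graph.ι ''
        (ofSpecialFibre X d S h36 Sigma SigmaHat hsub hne hprime hp TpH HatH hle cuspMeetsH).graph.TpH))
    (hker : ((ofSpecialFibre X d S h36 Sigma SigmaHat hsub hne hprime hp TpH HatH hle cuspMeetsH).ρHat.ker :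
        Set (ofSpecialFibre X d S h36 Sigma SigmaHat hsub hne hprime hp TpH HatH hle cuspMeetsH).DeltaHat) ⊆
      closure (((ofSpecialFibre X d S h36 Sigma SigmaHat hsub hne hprime hp TpH HatH hle cuspMeetsH).ιΔ.range :
          Set (ofSpecialFibre X d S h36 Sigma SigmaHat hsub hne hprime hp TpH HatH hle cuspMeetsH).DeltaHat) ∩
        ((ofSpecialFibre X d S h36 Sigma SigmaHat hsub hne hprime hp TpH HatH hle cuspMeetsH).ρHat.ker :
          Set (ofSpecialFibre X d S h36 Sigma SigmaHat hsub hne hprime hp TpH HatH hle cuspMeetsH).DeltaHat)))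
    (hOutTp : ∀ g : (ofSpecialFibre X d S h36 Sigma SigmaHat hsub hne hprime hp TpH HatH hle cuspMeetsH).PiTp,
      ∃ δ : (ofSpecialFibre X d S h36 Sigma SigmaHat hsub hne hprime hp TpH HatH hle cuspMeetsH).DeltaTp,
        MulAut.conj g • ((ofSpecialFibre X d S h36 Sigma SigmaHat hsub hne hprime hp TpH HatH hle
            cuspMeetsH).deltaTpH.map
          (ofSpecialFibre X d S h36 Sigma SigmaHat hsub hne hprime hp TpH HatH hle cuspMeetsH).DeltaTp.subtype) =
        MulAut.conj (δ : (ofSpecialFibre X d S h36 Sigma SigmaHat hsub hne hprime hp TpH HatH hle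
            cuspMeetsH).PiTp) •
          ((ofSpecialFibre X d S h36 Sigma SigmaHat hsub hne hprime hp TpH HatH hle cuspMeetsH).deltaTpH.map
            (ofSpecialFibre X d S h36 Sigma SigmaHat hsub hne hprime hp TpH HatH hle cuspMeetsH).DeltaTp.subtype))
    (hA' : (∃ l ∈ SigmaHat, l ∉ Sigma ∧ l ≠ p) →
      ∀ W : Subgroup (ofSpecialFibre X d S h36 Sigma SigmaHat hsub hne hprime hp TpH HatH hle cuspMeetsH).DeltaHat,
        W.Normal → IsOpen (W : Set (ofSpecialFibre X d S h36 Sigma SigmaHat hsub hne hprime hp TpH HatH hle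
          cuspMeetsH).DeltaHat) →
        ∀ a : (ofSpecialFibre X d S h36 Sigma SigmaHat hsub hne hprime hp TpH HatH hle cuspMeetsH).DeltaHat,
          (∀ x ∈ W, x ∈ (ofSpecialFibre X d S h36 Sigma SigmaHat hsub hne hprime hp TpH HatH hle
            cuspMeetsH).ρHat.ker → a * x = x * a) → a ∈ W)
    (hB' : SigmaHat = {q | q.Prime} →
      ∀ W : Subgroup (ofSpecialFibre X d S h36 Sigma SigmaHat hsub hne hprime hp TpH HatH hle cuspMeetsH).DeltaHat,
        W.Normal → IsOpen (W : Set (ofSpecialFibre X d S h36 Sigma SigmaHat hsub hne hprime hp TpH HatH hle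
          cuspMeetsH).DeltaHat) →
        ∀ a : (ofSpecialFibre X d S h36 Sigma SigmaHat hsub hne hprime hp TpH HatH hle cuspMeetsH).DeltaHat,
          (∀ x ∈ W, x ∈ (ofSpecialFibre X d S h36 Sigma SigmaHat hsub hne hprime hp TpH HatH hle
            cuspMeetsH).ρHat.ker → a * x = x * a) → a ∈ W) :
    (ofSpecialFibre X d S h36 Sigma SigmaHat hsub hne hprime hp TpH HatH hle cuspMeetsH).Cor23i ∧
      (ofSpecialFibre X d S h36 Sigma SigmaHat hsub hne hprime hp TpH HatH hle cuspMeetsH).Cor23ii ∧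
      (ofSpecialFibre X d S h36 Sigma SigmaHat hsub hne hprime hp TpH HatH hle cuspMeetsH).Cor23iii ∧
      (ofSpecialFibre X d S h36 Sigma SigmaHat hsub hne hprime hp TpH HatH hle cuspMeetsH).Cor23iv := by
  haveI := ofSpecialFibre_t2Space_graphHat X d S h36 Sigma SigmaHat hsub hne hprime hp TpH HatH hle cuspMeetsH
  have hii : (ofSpecialFibre X d S h36 Sigma SigmaHat hsub hne hprime hp TpH HatH hle cuspMeetsH).Cor23ii :=
    (ofSpecialFibre X d S h36 Sigma SigmaHat hsub hne hprime hp TpH HatH hle cuspMeetsH).cor23ii_of_density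
      (ofSpecialFibre_isClosed_deltaHat X d S h36 Sigma SigmaHat hsub hne hprime hp TpH HatH hle cuspMeetsH)
      (ofSpecialFibre_continuous_ρHat X d S h36 Sigma SigmaHat hsub hne hprime hp TpH HatH hle cuspMeetsH)
      hH hker
  exact cor23_i_to_iv_ofSpecialFibre_allLevels X d S h36 Sigma SigmaHat hsub hne hprime hp TpH HatH hle
    cuspMeetsH h22 hH hker hOutTp
    ((ofSpecialFibre X d S h36 Sigma SigmaHat hsub hne hprime hp TpH HatH hle cuspMeetsH).outerHat_of_outerTp
      hii hOutTp)
    hA' hB'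

end

end StableCurveTemperedData

end Literature.IUT.HodgeTheaters

end
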